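import Mathlib
import HarnessLib
import Literature.Analysis.FluidPDE.VorticityCalculus
import Literature.Analysis.FluidPDE.AxisymNoSwirlVorticity
import Literature.Analysis.FunctionSpaces.SmoothParametricIntegral
import Summits.NavierStokesRegularity.NavierStokesRegularity.Theorems.AxisTwistDoorAveragedConeLiouvilleDefs
import Summits.NavierStokesRegularity.NavierStokesRegularity.Theorems.AxisTwistDoorAveragedConeLiouvilleCircleStokes
import Summits.NavierStokesRegularity.NavierStokesRegularity.Theorems.AxisTwistDoorAveragedConeLiouvilleCylFrame

/-!
# Route `AxisTwistDoor`, crux `AveragedConeLiouville` (stmt-NavierStokesRegularity-26889), line `lrt_shell`,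
# stub (1) `stub_circleSwirl` — brick B2a: CALCULUS OF THE CIRCLE FUNCTIONALS

Elementary calculus of the circle functionals of `AxisTwistDoorAveragedConeLiouvilleDefs` about the vertical axis
(`circ = Γ`, `vortCirc = ∮ω₃ dl`, `radVortCirc = ∮ω_r dl`), continuing `…CircleStokes` (`∂ᵣΓ = ∮ω₃ dl`) and the
LEAD's frame file `…CylFrame` (whose `inner_curl_eR_mul`, `integral_fderiv_tangent_apply_two`, `contDiff_cylPt_comp`,
`hasDerivAt_cylPt_z`, `continuous_cylPt_θ` are reused, not restated):

* one derivative under the integral sign in `r` and in `z` for frame integrals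
  `∫₀^{2π} ⟪w(cylPt r θ z), f θ⟫ r dθ` of a `C¹` field `w` against a `C¹` frame field `f`
  (`hasDerivAt_frameIntegral_r`, `hasDerivAt_frameIntegral_z`);
* `∂_zΓ = −∮ω_r dl` (`hasDerivAt_circ_z`, from the LEAD's pointwise `r ω_r = ∂_θ v₃ − r ∂_z v_θ` and periodicity);
* `∂ᵣ ∮ω₃ dl` and `∂_z ∮ω_r dl` for `C²` slices (`hasDerivAt_vortCirc_r`, `hasDerivAt_radVortCirc_z`);
* the pointwise VISCOUS identity `−r (curl ω)_θ = r ∂ᵣω… − r ∂_z…` in the frame (`viscous_pointwise`),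
  the pointwise CONVECTIVE identity `⟪(w·∇)w, e_θ⟫ = ⟪Dw e_θ, w⟫ + (w_r ω₃ − ω_r w₃)` (`convective_pointwise`),
  and the two periodicity cancellations `∮ ⟪Dw e_θ, w⟫ r dθ = 0` (kinetic) and `∮ ⟪∇g, e_θ⟫ r dθ = 0` (pressure).

These are the ingredients of the circle-averaged swirl identity (second conjunct of `CircleSwirlEquation`), assembled
for classical solutions in `…CircleSwirl`.

WHAT THIS IS NOT: calculus lemmas about circle integrals of smooth fields; nothing about Navier–Stokes regularity
(Clay A) is proved or claimed, and no item is closed by this file (`--supports` stmt-…-26889 only).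
-/

noncomputable section

-- the summit and its single sub-problem share the name (CONVENTIONS §1), as in every Theorems file
set_option linter.dupNamespace false

namespace Summit.NavierStokesRegularity.NavierStokesRegularity.Theorems.AveragedConeLiouville.CircleCalculus

open scoped Topology InnerProductSpace
open Set Function MeasureTheory intervalIntegral
open Literature.Analysis Literature.Analysis.FunctionSpaces
open Literature.Analysis.FluidPDE hiding eR
open Summit.NavierStokesRegularity.NavierStokesRegularity.Theorems.AxisTwistDoorAveragedConeLiouvilleDefs
open Summit.NavierStokesRegularity.NavierStokesRegularity.Theorems.AveragedConeLiouville.CircleStokes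
open Summit.NavierStokesRegularity.NavierStokesRegularity.Theorems.AxisTwistDoorAveragedConeLiouvilleCylFrame

/-! ### More frame facts -/

/-- Expansion of a vector of `ℝ³` in the standard basis. -/
theorem eq_sum_single (a : EuclideanSpace ℝ (Fin 3)) :
    a = a 0 • (EuclideanSpace.single (0 : Fin 3) (1 : ℝ)) + a 1 • (EuclideanSpace.single (1 : Fin 3) (1 : ℝ))
      + a 2 • (EuclideanSpace.single (2 : Fin 3) (1 : ℝ)) := by
  ext i
  fin_cases i <;> simp

/-- `(θ, z') ↦ cylPt r θ z'` is smooth on `ℝ × ℝ`. -/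
theorem contDiff_cylPt_z (r : ℝ) {n : WithTop ℕ∞} :
    ContDiff ℝ n (fun q : ℝ × ℝ => cylPt r q.1 q.2) :=
  contDiff_cylPt_comp contDiff_const contDiff_fst contDiff_snd

/-- `θ ↦ e_r(θ)` is smooth. -/
theorem contDiff_eR {n : WithTop ℕ∞} : ContDiff ℝ n eR := by
  rw [show eR = fun θ => Real.cos θ • (EuclideanSpace.single (0 : Fin 3) (1 : ℝ))
      + Real.sin θ • (EuclideanSpace.single (1 : Fin 3) (1 : ℝ)) from funext eR_eq]
  fun_prop

/-! ### One derivative under the integral sign for frame integrals -/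

variable {w : EuclideanSpace ℝ (Fin 3) → EuclideanSpace ℝ (Fin 3)} {f : ℝ → EuclideanSpace ℝ (Fin 3)}

/-- `∂ᵣ [⟪w(cylPt r θ z), f θ⟫ r] = ⟪Dw(cylPt r θ z) e_r, f θ⟫ r + ⟪w(cylPt r θ z), f θ⟫`. -/
theorem hasDerivAt_frameIntegrand_r (hw : ContDiff ℝ 1 w) (f : ℝ → EuclideanSpace ℝ (Fin 3)) (r θ z : ℝ) :
    HasDerivAt (fun r' => ⟪w (cylPt r' θ z), f θ⟫_ℝ * r')
      (⟪fderiv ℝ w (cylPt r θ z) (eR θ), f θ⟫_ℝ * r + ⟪w (cylPt r θ z), f θ⟫_ℝ) r := by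
  have h1 : HasDerivAt (fun r' => w (cylPt r' θ z)) (fderiv ℝ w (cylPt r θ z) (eR θ)) r :=
    ((hw.differentiable one_ne_zero) _).hasFDerivAt.comp_hasDerivAt r (hasDerivAt_cylPt_r r θ z)
  have h2 : HasDerivAt (fun r' => ⟪w (cylPt r' θ z), f θ⟫_ℝ)
      (⟪fderiv ℝ w (cylPt r θ z) (eR θ), f θ⟫_ℝ) r := by
    simpa using h1.inner ℝ (hasDerivAt_const r (f θ))
  have h3 : HasDerivAt (fun r' => ⟪w (cylPt r' θ z), f θ⟫_ℝ * r')
      (⟪fderiv ℝ w (cylPt r θ z) (eR θ), f θ⟫_ℝ * id r + ⟪w (cylPt r θ z), f θ⟫_ℝ * 1) r :=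
    h2.mul (hasDerivAt_id r)
  simpa using h3

/-- `∂_z [⟪w(cylPt r θ z), f θ⟫ r] = ⟪Dw(cylPt r θ z) e₃, f θ⟫ r`. -/
theorem hasDerivAt_frameIntegrand_z (hw : ContDiff ℝ 1 w) (f : ℝ → EuclideanSpace ℝ (Fin 3)) (r θ z : ℝ) :
    HasDerivAt (fun z' => ⟪w (cylPt r θ z'), f θ⟫_ℝ * r)
      (⟪fderiv ℝ w (cylPt r θ z) e3, f θ⟫_ℝ * r) z := by
  have h1 : HasDerivAt (fun z' => w (cylPt r θ z')) (fderiv ℝ w (cylPt r θ z) e3) z :=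
    ((hw.differentiable one_ne_zero) _).hasFDerivAt.comp_hasDerivAt z (hasDerivAt_cylPt_z r θ z)
  have h2 : HasDerivAt (fun z' => ⟪w (cylPt r θ z'), f θ⟫_ℝ) (⟪fderiv ℝ w (cylPt r θ z) e3, f θ⟫_ℝ) z := by
    simpa using h1.inner ℝ (hasDerivAt_const z (f θ))
  exact h2.mul_const r

/-- The `r`-parametrised frame integrand `(θ, r') ↦ ⟪w(cylPt r' θ z), f θ⟫ r'` is `C¹`. -/
theorem contDiff_frameIntegrand_r (hw : ContDiff ℝ 1 w) (hf : ContDiff ℝ 1 f) (z : ℝ) :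
    ContDiff ℝ 1 fun q : ℝ × ℝ => ⟪w (cylPt q.2 q.1 z), f q.1⟫_ℝ * q.2 :=
  ((hw.comp (contDiff_cylPt z)).inner ℝ (hf.comp contDiff_fst)).mul contDiff_snd

/-- The `z`-parametrised frame integrand `(θ, z') ↦ ⟪w(cylPt r θ z'), f θ⟫ r` is `C¹`. -/
theorem contDiff_frameIntegrand_z (hw : ContDiff ℝ 1 w) (hf : ContDiff ℝ 1 f) (r : ℝ) :
    ContDiff ℝ 1 fun q : ℝ × ℝ => ⟪w (cylPt r q.1 q.2), f q.1⟫_ℝ * r :=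
  ((hw.comp (contDiff_cylPt_z r)).inner ℝ (hf.comp contDiff_fst)).mul contDiff_const

/-- One derivative under `∫₀^{2π}` for a `C¹` integrand `H (θ, p)`, `deriv` in the parameter `p : ℝ`, with the
partial derivative identified by a pointwise `HasDerivAt` in `p`. -/
theorem hasDerivAt_intervalIntegral_of_contDiff {H : ℝ × ℝ → ℝ} (hH : ContDiff ℝ 1 H) {g : ℝ → ℝ} (p : ℝ)
    (hg : ∀ θ : ℝ, HasDerivAt (fun p' => H (θ, p')) (g θ) p) :
    HasDerivAt (fun p' => ∫ θ in (0 : ℝ)..(2 * Real.pi), H (θ, p'))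
      (∫ θ in (0 : ℝ)..(2 * Real.pi), g θ) p := by
  have hF := hasFDerivAt_parametric_intervalIntegral hH one_ne_zero 0 (2 * Real.pi) p
  have hpt : ∀ θ : ℝ, fderiv ℝ H (θ, p) ((0 : ℝ), (1 : ℝ)) = g θ := fun θ => by
    have hc : HasDerivAt (fun p' : ℝ => ((θ, p') : ℝ × ℝ)) ((0 : ℝ), (1 : ℝ)) p :=
      (hasDerivAt_const p θ).prodMk (hasDerivAt_id p)
    exact (((hH.differentiable one_ne_zero) (θ, p)).hasFDerivAt.comp_hasDerivAt p hc).unique (hg θ)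
  have key : (∫ σ in (0 : ℝ)..(2 * Real.pi),
      (fderiv ℝ H (σ, p)).comp (ContinuousLinearMap.inr ℝ ℝ ℝ)) (1 : ℝ)
        = ∫ θ in (0 : ℝ)..(2 * Real.pi), g θ := by
    rw [← hF.fderiv, fderiv_parametric_intervalIntegral_apply hH one_ne_zero 0 (2 * Real.pi) p 1,
      intervalIntegral.integral_congr (fun θ _ => hpt θ)]
  have hd := hF.hasDerivAt
  rw [key] at hd
  exact hd

/-- **`∂ᵣ` of a frame integral**: `d/dr ∫₀^{2π} ⟪w(cylPt r θ z), f θ⟫ r dθ = ∫₀^{2π} (⟪Dw e_r, f θ⟫ r + ⟪w, f θ⟫) dθ`. -/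
theorem hasDerivAt_frameIntegral_r (hw : ContDiff ℝ 1 w) (hf : ContDiff ℝ 1 f) (r z : ℝ) :
    HasDerivAt (fun r' => ∫ θ in (0 : ℝ)..(2 * Real.pi), ⟪w (cylPt r' θ z), f θ⟫_ℝ * r')
      (∫ θ in (0 : ℝ)..(2 * Real.pi),
        (⟪fderiv ℝ w (cylPt r θ z) (eR θ), f θ⟫_ℝ * r + ⟪w (cylPt r θ z), f θ⟫_ℝ)) r :=
  hasDerivAt_intervalIntegral_of_contDiff (contDiff_frameIntegrand_r hw hf z) r
    fun θ => hasDerivAt_frameIntegrand_r hw f r θ z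

/-- **`∂_z` of a frame integral**: `d/dz ∫₀^{2π} ⟪w(cylPt r θ z), f θ⟫ r dθ = ∫₀^{2π} ⟪Dw e₃, f θ⟫ r dθ`. -/
theorem hasDerivAt_frameIntegral_z (hw : ContDiff ℝ 1 w) (hf : ContDiff ℝ 1 f) (r z : ℝ) :
    HasDerivAt (fun z' => ∫ θ in (0 : ℝ)..(2 * Real.pi), ⟪w (cylPt r θ z'), f θ⟫_ℝ * r)
      (∫ θ in (0 : ℝ)..(2 * Real.pi), ⟪fderiv ℝ w (cylPt r θ z) e3, f θ⟫_ℝ * r) z :=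
  hasDerivAt_intervalIntegral_of_contDiff (contDiff_frameIntegrand_z hw hf r) z
    fun θ => hasDerivAt_frameIntegrand_z hw f r θ z

/-! ### `∂_zΓ = −∮ω_r dl` -/

/-- **`∂_zΓ = −∮ω_r dl`** for a `C¹` field: `d/dz ∫₀^{2π} ⟪w(cylPt r θ z), e_θ⟫ r dθ = −∫₀^{2π} ⟪curl w, e_r⟫ r dθ`. -/
theorem hasDerivAt_circleIntegral_z (hw : ContDiff ℝ 1 w) (r z : ℝ) :
    HasDerivAt (fun z' => ∫ θ in (0 : ℝ)..(2 * Real.pi), ⟪w (cylPt r θ z'), eT θ⟫_ℝ * r)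
      (-(∫ θ in (0 : ℝ)..(2 * Real.pi), ⟪curl w (cylPt r θ z), eR θ⟫_ℝ * r)) z := by
  have h := hasDerivAt_frameIntegral_z hw contDiff_eT r z
  -- pointwise `r ⟪Dw e₃, e_θ⟫ = −r ω_r + ∂_θ w₃` (the LEAD's `inner_curl_eR_mul`, rearranged)
  have hpt : ∀ θ : ℝ, ⟪fderiv ℝ w (cylPt r θ z) e3, eT θ⟫_ℝ * r
      = -(⟪curl w (cylPt r θ z), eR θ⟫_ℝ * r) + fderiv ℝ w (cylPt r θ z) (r • eT θ) 2 := fun θ => by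
    rw [inner_curl_eR_mul w r θ z]
    ring
  have hcurl : Continuous fun θ => ⟪curl w (cylPt r θ z), eR θ⟫_ℝ * r :=
    (((continuous_curl hw).comp (continuous_cylPt_θ r z)).inner continuous_eR).mul continuous_const
  have hc2 : Continuous fun θ => fderiv ℝ w (cylPt r θ z) (r • eT θ) 2 :=
    (EuclideanSpace.proj (2 : Fin 3) : EuclideanSpace ℝ (Fin 3) →L[ℝ] ℝ).continuous.comp
      (((hw.continuous_fderiv one_ne_zero).comp (continuous_cylPt_θ r z)).clm_apply
        (continuous_eT.const_smul r))
  rw [intervalIntegral.integral_congr (fun θ _ => hpt θ),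
    intervalIntegral.integral_add (f := fun θ => -(⟪curl w (cylPt r θ z), eR θ⟫_ℝ * r))
      (hcurl.neg.intervalIntegrable _ _) (hc2.intervalIntegrable _ _),
    integral_fderiv_tangent_apply_two hw r z, add_zero, intervalIntegral.integral_neg] at h
  exact h

/-- **`∂_zΓ = −∮ω_r dl`** in the crux vocabulary, for a `C¹` slice `v s`. -/
theorem hasDerivAt_circ_z (v : ℝ → EuclideanSpace ℝ (Fin 3) → EuclideanSpace ℝ (Fin 3)) {s : ℝ}
    (hv : ContDiff ℝ 1 (v s)) (r z : ℝ) :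
    HasDerivAt (fun z' => circ v r z' s) (-radVortCirc v r z s) z := by
  unfold circ radVortCirc
  exact hasDerivAt_circleIntegral_z hv r z

/-- `deriv (fun z' => circ v r z' s) z = -radVortCirc v r z s` for a `C¹` slice. -/
theorem deriv_circ_z (v : ℝ → EuclideanSpace ℝ (Fin 3) → EuclideanSpace ℝ (Fin 3)) {s : ℝ}
    (hv : ContDiff ℝ 1 (v s)) (r z : ℝ) :
    deriv (fun z' => circ v r z' s) z = -radVortCirc v r z s :=
  (hasDerivAt_circ_z v hv r z).deriv

/-! ### Derivatives of the vorticity circle integrals (for `C²` slices) -/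

/-- `∂ᵣ ∮ω₃ dl = ∫₀^{2π} (⟪Dω e_r, e₃⟫ r + ⟪ω, e₃⟫) dθ`, `ω = curl (v s)`, for a `C²` slice. -/
theorem hasDerivAt_vortCirc_r (v : ℝ → EuclideanSpace ℝ (Fin 3) → EuclideanSpace ℝ (Fin 3)) {s : ℝ}
    (hv : ContDiff ℝ 2 (v s)) (r z : ℝ) :
    HasDerivAt (fun r' => vortCirc v r' z s)
      (∫ θ in (0 : ℝ)..(2 * Real.pi), (⟪fderiv ℝ (curl (v s)) (cylPt r θ z) (eR θ), e3⟫_ℝ * r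
        + ⟪curl (v s) (cylPt r θ z), e3⟫_ℝ)) r := by
  unfold vortCirc
  have hω : ContDiff ℝ 1 (curl (v s)) := contDiff_curl (n := 1) (by exact_mod_cast hv)
  exact hasDerivAt_frameIntegral_r hω (f := fun _ => e3) contDiff_const r z

/-- `∂_z ∮ω_r dl = ∫₀^{2π} ⟪Dω e₃, e_r⟫ r dθ`, `ω = curl (v s)`, for a `C²` slice. -/
theorem hasDerivAt_radVortCirc_z (v : ℝ → EuclideanSpace ℝ (Fin 3) → EuclideanSpace ℝ (Fin 3)) {s : ℝ}
    (hv : ContDiff ℝ 2 (v s)) (r z : ℝ) :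
    HasDerivAt (fun z' => radVortCirc v r z' s)
      (∫ θ in (0 : ℝ)..(2 * Real.pi), ⟪fderiv ℝ (curl (v s)) (cylPt r θ z) e3, eR θ⟫_ℝ * r) z := by
  unfold radVortCirc
  have hω : ContDiff ℝ 1 (curl (v s)) := contDiff_curl (n := 1) (by exact_mod_cast hv)
  exact hasDerivAt_frameIntegral_z hω contDiff_eR r z

/-! ### The pointwise viscous and convective identities -/

/-- VISCOUS, pointwise, for a `C¹` field `ω` (applied to `ω = curl v`): `−⟪curl ω, e_θ⟫ r = ⟪Dω e_r, e₃⟫ r − ⟪Dω e₃, e_r⟫ r`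
(`−r (curl ω)_θ = r ∂ᵣω₃ − r ∂_z ω_r`; the antisymmetric part of `Dω` paired with `e₃ ∧ e_r`). -/
theorem viscous_pointwise {ω : EuclideanSpace ℝ (Fin 3) → EuclideanSpace ℝ (Fin 3)} (r θ z : ℝ) :
    -(⟪curl ω (cylPt r θ z), eT θ⟫_ℝ * r)
      = ⟪fderiv ℝ ω (cylPt r θ z) (eR θ), e3⟫_ℝ * r - ⟪fderiv ℝ ω (cylPt r θ z) e3, eR θ⟫_ℝ * r := by
  set L := fderiv ℝ ω (cylPt r θ z) with hL
  have h0 : curl ω (cylPt r θ z) 0 = L (EuclideanSpace.single 1 1) 2 - L (EuclideanSpace.single 2 1) 1 := by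
    simp [curl, hL]
  have h1 : curl ω (cylPt r θ z) 1 = L (EuclideanSpace.single 2 1) 0 - L (EuclideanSpace.single 0 1) 2 := by
    simp [curl, hL]
  rw [eR_eq, eT_eq, e3_eq]
  simp only [map_add, map_smul, inner_add_left, inner_add_right, inner_smul_left,
    inner_smul_right, inner_neg_right, neg_smul,
    EuclideanSpace.inner_single_right, RCLike.conj_to_real, h0, h1]
  ring

/-- CONVECTIVE, pointwise (the `e_θ`-component of the Lamb form `(w·∇)w = ω × w + ∇|w|²/2`):
`⟪Dw(p) (w p), e_θ⟫ = ⟪Dw(p) e_θ, w p⟫ + (⟪w p, e_r⟫⟪curl w p, e₃⟫ − ⟪curl w p, e_r⟫⟪w p, e₃⟫)`. -/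
theorem convective_pointwise (r θ z : ℝ) :
    ⟪fderiv ℝ w (cylPt r θ z) (w (cylPt r θ z)), eT θ⟫_ℝ
      = ⟪fderiv ℝ w (cylPt r θ z) (eT θ), w (cylPt r θ z)⟫_ℝ
        + (⟪w (cylPt r θ z), eR θ⟫_ℝ * ⟪curl w (cylPt r θ z), e3⟫_ℝ
          - ⟪curl w (cylPt r θ z), eR θ⟫_ℝ * ⟪w (cylPt r θ z), e3⟫_ℝ) := by
  set L := fderiv ℝ w (cylPt r θ z) with hL
  set a := w (cylPt r θ z) with ha
  have h0 : curl w (cylPt r θ z) 0 = L (EuclideanSpace.single 1 1) 2 - L (EuclideanSpace.single 2 1) 1 := by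
    simp [curl, hL]
  have h1 : curl w (cylPt r θ z) 1 = L (EuclideanSpace.single 2 1) 0 - L (EuclideanSpace.single 0 1) 2 := by
    simp [curl, hL]
  have h2 : curl w (cylPt r θ z) 2 = L (EuclideanSpace.single 0 1) 1 - L (EuclideanSpace.single 1 1) 0 := by
    simp [curl, hL]
  rw [eq_sum_single a, eR_eq, eT_eq, e3_eq]
  simp only [map_add, map_smul, map_neg, inner_add_left, inner_add_right, inner_smul_left,
    inner_smul_right, inner_neg_left, inner_neg_right, neg_smul,
    EuclideanSpace.inner_single_right, RCLike.conj_to_real, h0, h1, h2, PiLp.single_apply]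
  simp
  ring

/-! ### The two periodicity cancellations -/

/-- KINETIC: `∫₀^{2π} ⟪Dw(cylPt r θ z) e_θ, w(cylPt r θ z)⟫ r dθ = 0` (`= ∮ ∂_θ |w|²/2`). -/
theorem integral_kinetic_eq_zero (hw : ContDiff ℝ 1 w) (r z : ℝ) :
    ∫ θ in (0 : ℝ)..(2 * Real.pi), ⟪fderiv ℝ w (cylPt r θ z) (eT θ), w (cylPt r θ z)⟫_ℝ * r = 0 := by
  have hd : ∀ θ : ℝ, HasDerivAt (fun θ' => ⟪w (cylPt r θ' z), w (cylPt r θ' z)⟫_ℝ / 2)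
      (⟪fderiv ℝ w (cylPt r θ z) (eT θ), w (cylPt r θ z)⟫_ℝ * r) θ := fun θ => by
    have h1 : HasDerivAt (fun θ' => w (cylPt r θ' z)) (fderiv ℝ w (cylPt r θ z) (r • eT θ)) θ :=
      ((hw.differentiable one_ne_zero) _).hasFDerivAt.comp_hasDerivAt θ (hasDerivAt_cylPt_theta r θ z)
    have h2 := (h1.inner ℝ h1).div_const 2
    refine h2.congr_deriv ?_
    rw [map_smul, inner_smul_left, inner_smul_right, real_inner_comm (w (cylPt r θ z))]
    simp
    ring
  have hc : Continuous fun θ => ⟪fderiv ℝ w (cylPt r θ z) (eT θ), w (cylPt r θ z)⟫_ℝ * r :=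
    ((((hw.continuous_fderiv one_ne_zero).comp (continuous_cylPt_θ r z)).clm_apply
      continuous_eT).inner (hw.continuous.comp (continuous_cylPt_θ r z))).mul continuous_const
  rw [integral_eq_sub_of_hasDerivAt (fun θ _ => hd θ) (hc.intervalIntegrable _ _), cylPt_two_pi, sub_self]

/-- PRESSURE: `∫₀^{2π} ⟪∇g(cylPt r θ z), e_θ⟫ r dθ = 0` for a `C¹` scalar `g` (`= ∮ ∂_θ g`). -/
theorem integral_pressure_eq_zero {g : EuclideanSpace ℝ (Fin 3) → ℝ} (hg : ContDiff ℝ 1 g) (r z : ℝ) :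
    ∫ θ in (0 : ℝ)..(2 * Real.pi), ⟪gradient g (cylPt r θ z), eT θ⟫_ℝ * r = 0 := by
  have hpt : ∀ θ : ℝ, ⟪gradient g (cylPt r θ z), eT θ⟫_ℝ * r = fderiv ℝ g (cylPt r θ z) (r • eT θ) := fun θ => by
    rw [gradient, InnerProductSpace.toDual_symm_apply, map_smul, smul_eq_mul, mul_comm]
  have hd : ∀ θ : ℝ, HasDerivAt (fun θ' => g (cylPt r θ' z)) (fderiv ℝ g (cylPt r θ z) (r • eT θ)) θ :=
    fun θ => ((hg.differentiable one_ne_zero) _).hasFDerivAt.comp_hasDerivAt θ (hasDerivAt_cylPt_theta r θ z)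
  have hc : Continuous fun θ => fderiv ℝ g (cylPt r θ z) (r • eT θ) :=
    ((hg.continuous_fderiv one_ne_zero).comp (continuous_cylPt_θ r z)).clm_apply
      (continuous_eT.const_smul r)
  rw [intervalIntegral.integral_congr (fun θ _ => hpt θ),
    integral_eq_sub_of_hasDerivAt (fun θ _ => hd θ) (hc.intervalIntegrable _ _), cylPt_two_pi, sub_self]

end Summit.NavierStokesRegularity.NavierStokesRegularity.Theorems.AveragedConeLiouville.CircleCalculus

end
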